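import Summits.HodgeConjecture.HodgeConjecture.Theses.NodalThetaWeil
import HarnessLib

/-!
# Route `NodalThetaWeil`, support `WeilClassesPrimitive` (stmt-HodgeConjecture-7746)

For `(A, φ)`, `φ ≫ φ = -d·𝟙`, of dimension `2n` (`n ≥ 1`, `d ≥ 1`): granted the character
decomposition of `H²ⁿ⁺²(A(ℂ);ℂ)` into simultaneous `(x·𝟙 + y·φ)^*`-eigenclasses of the characters
`(x + iy√d)ᵃ (x - iy√d)ᵇ`, `a + b = 2n + 2`, `a, b ≤ 2n`, every degree-`2` class `e` of character
`(x + iy√d)(x - iy√d)` cups to zero against the Weil plane `E₊ ⊔ E₋`: `e ∪ w₊` is an eigenclass of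
the FORBIDDEN character `(x + iy√d)^{2n+1} (x - iy√d)`, hence vanishes.

## Proof

Fix ONE operator `T = (x₀·𝟙 + φ)^*` with `x₀ ∈ ℕ` chosen so that `(x₀ + i√d)ᵏ ≠ (x₀ - i√d)ᵏ` for all
`1 ≤ k ≤ 2n + 1` (`exists_nat_forall_natCast_add_pow_ne`: for each `k` only finitely many `x` fail,
by the polynomial identity argument of `eq_zero_of_forall_natCast_add_pow_eq`). With
`u = x₀ + i√d`, `w = x₀ - i√d` (both non-zero, `uw = x₀² + d`), `e ∪ w₊` lies in the `T`-eigenspace of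
`μ = u w · u²ⁿ`, and by the decomposition in the span of the `T`-eigenspaces of the values `uᵃ wᵇ`,
all `≠ μ` (else `u^{2n+1-a} = w^{2n+1-a}` after cancelling); eigenspaces of one endomorphism for
distinct eigenvalues are independent (`Module.End.eigenspaces_iSupIndep`), so `e ∪ w₊ = 0`;
symmetrically for `w₋`.
-/

set_option linter.dupNamespace false

noncomputable section

namespace Summit.HodgeConjecture.HodgeConjecture.Theorems

open CategoryTheory
open Literature.AlgebraicGeometry.Motives Literature.AlgebraicGeometry.HodgeTheory
  Literature.AlgebraicTopology.SingularHomology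

/-- Over `ℂ`, for `a ≠ 0` and `k ≥ 1`, only finitely many natural numbers `x` satisfy
`(x + a)ᵏ = (x - a)ᵏ`: otherwise the polynomials `(X + a)ᵏ`, `(X - a)ᵏ` agree on an infinite set,
hence coincide, and comparing the coefficients of `X^{k-1}` gives `a = 0`. [folklore] -/
theorem finite_setOf_natCast_add_pow_eq {a : ℂ} (ha : a ≠ 0) {k : ℕ} (hk : 0 < k) :
    {x : ℕ | ((x : ℂ) + a) ^ k = ((x : ℂ) - a) ^ k}.Finite := by
  by_contra hinf
  apply ha
  obtain ⟨m, rfl⟩ : ∃ j, k = j + 1 := ⟨k - 1, by omega⟩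
  have hpq : ((Polynomial.X + Polynomial.C a) ^ (m + 1) : Polynomial ℂ) =
      (Polynomial.X + Polynomial.C (-a)) ^ (m + 1) := by
    apply Polynomial.eq_of_infinite_eval_eq
    refine ((Set.not_finite.mp hinf).image Nat.cast_injective.injOn).mono ?_
    rintro _ ⟨x, hx, rfl⟩
    simp only [Set.mem_setOf_eq, Polynomial.eval_pow, Polynomial.eval_add, Polynomial.eval_X,
      Polynomial.eval_C, ← sub_eq_add_neg]
    exact hx
  have hc := congrArg (fun p : Polynomial ℂ => p.coeff m) hpq
  simp only [Polynomial.coeff_X_add_C_pow, Nat.add_sub_cancel_left, pow_one,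
    Nat.choose_succ_self_right] at hc
  have h2 : (2 * a) * ((m + 1 : ℕ) : ℂ) = 0 := by linear_combination hc
  rcases mul_eq_zero.mp h2 with h3 | h3
  · exact (mul_eq_zero.mp h3).resolve_left two_ne_zero
  · exact absurd h3 (Nat.cast_ne_zero.mpr (Nat.succ_ne_zero m))

/-- Hence for `a ≠ 0` and any bound `K` there is a natural number `x` with
`(x + a)ᵏ ≠ (x - a)ᵏ` for ALL `1 ≤ k ≤ K` simultaneously (`ℕ` is not a finite union of finite sets).
[folklore] -/
theorem exists_nat_forall_natCast_add_pow_ne {a : ℂ} (ha : a ≠ 0) (K : ℕ) :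
    ∃ x : ℕ, ∀ k : ℕ, 0 < k → k ≤ K → ((x : ℂ) + a) ^ k ≠ ((x : ℂ) - a) ^ k := by
  have hfin : (⋃ k ∈ Finset.Icc 1 K, {x : ℕ | ((x : ℂ) + a) ^ k = ((x : ℂ) - a) ^ k}).Finite :=
    Set.Finite.biUnion (Finset.finite_toSet _) fun k hk ↦
      finite_setOf_natCast_add_pow_eq ha (by simp only [Finset.coe_Icc, Set.mem_Icc] at hk; omega)
  obtain ⟨x, -, hx⟩ := (Set.infinite_univ.sdiff hfin).nonempty
  exact ⟨x, fun k hk hkK h ↦ hx (Set.mem_iUnion₂.mpr ⟨k, Finset.mem_Icc.mpr ⟨hk, hkK⟩, h⟩)⟩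

/-- **Support item `WeilClassesPrimitive` of route `NodalThetaWeil`** (stmt-HodgeConjecture-7746):
a `K`-hermitian degree-`2` class cups to zero against every Weil class. See the module docstring.
[cite: vanGeemen1994HodgeAV, 4.9 and proof of Thm. 6.12] [cite: Kleiman1968AlgebraicCycles, 2A8–2A11] -/
theorem nodalThetaWeil_weilClassesPrimitive_proof :
    Summit.HodgeConjecture.HodgeConjecture.Theses.NodalThetaWeil.WeilClassesPrimitive := by
  intro d hd n hn A φ hA hX hφ hdec e he c hc
  -- the numbers `u = x₀ + i√d`, `w = x₀ - i√d`
  have hs0 : (Real.sqrt d : ℂ) ≠ 0 := by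
    rw [Ne, Complex.ofReal_eq_zero]
    exact (Real.sqrt_pos.mpr (by exact_mod_cast hd)).ne'
  have hIs : Complex.I * (Real.sqrt d : ℂ) ≠ 0 := mul_ne_zero Complex.I_ne_zero hs0
  obtain ⟨x₀, hx₀⟩ := exists_nat_forall_natCast_add_pow_ne hIs (2 * n + 1)
  set u : ℂ := (x₀ : ℂ) + Complex.I * (Real.sqrt d : ℂ) with hu
  set w : ℂ := (x₀ : ℂ) - Complex.I * (Real.sqrt d : ℂ) with hw
  have hs2 : (Real.sqrt d : ℂ) ^ 2 = (d : ℂ) := by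
    rw [← Complex.ofReal_pow, Real.sq_sqrt (Nat.cast_nonneg d)]
    push_cast; rfl
  have huw : u * w = ((x₀ ^ 2 + d : ℕ) : ℂ) := by
    have h1 : u * w = (x₀ : ℂ) ^ 2 - Complex.I ^ 2 * (Real.sqrt d : ℂ) ^ 2 := by rw [hu, hw]; ring
    rw [h1, Complex.I_sq, hs2]; push_cast; ring
  have huw0 : u * w ≠ 0 := by rw [huw]; exact_mod_cast (show x₀ ^ 2 + d ≠ 0 by positivity)
  have hu0 : u ≠ 0 := left_ne_zero_of_mul huw0
  have hw0 : w ≠ 0 := right_ne_zero_of_mul huw0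
  have hx1 : ((x₀ : ℂ) + ((1 : ℕ) : ℂ) * Complex.I * (Real.sqrt d : ℂ)) = u := by
    rw [hu]; push_cast; ring
  have hx2 : ((x₀ : ℂ) - ((1 : ℕ) : ℂ) * Complex.I * (Real.sqrt d : ℂ)) = w := by
    rw [hw]; push_cast; ring
  -- the operator `T = (x₀·𝟙 + 1·φ)^*` on `H^{2n+2}`
  let T : Module.End ℂ (complexBetti A.X (2 * n + 2)) :=
    (singularCohomology.map ℂ ℂ (AlgPoints.mapContinuous (L := ℂ) (x₀ • 𝟙 A + (1 : ℕ) • φ).hom.hom.hom)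
      (2 * n + 2)).hom
  have hT : ∀ v, T v = singularCohomology.map ℂ ℂ
      (AlgPoints.mapContinuous (L := ℂ) (x₀ • 𝟙 A + (1 : ℕ) • φ).hom.hom.hom) (2 * n + 2) v :=
    fun v ↦ rfl
  -- KEY: a `T`-eigenclass for an eigenvalue off the spectrum `{uᵃ wᵇ}` vanishes
  have key : ∀ (μ : ℂ) (v : complexBetti A.X (2 * n + 2)),
      singularCohomology.map ℂ ℂ
        (AlgPoints.mapContinuous (L := ℂ) (x₀ • 𝟙 A + (1 : ℕ) • φ).hom.hom.hom) (2 * n + 2) v = μ • v →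
      (∀ a b : ℕ, a + b = 2 * n + 2 → a ≤ 2 * n → b ≤ 2 * n → u ^ a * w ^ b ≠ μ) → v = 0 := by
    intro μ v hv hne
    have hvμ : v ∈ T.eigenspace μ := Module.End.mem_eigenspace_iff.mpr (by rw [hT]; exact hv)
    have hvs : v ∈ ⨆ (ν : ℂ) (_ : ν ≠ μ), T.eigenspace ν := by
      have hle : (⨆ (a : ℕ) (b : ℕ) (_ : a + b = 2 * n + 2) (_ : a ≤ 2 * n) (_ : b ≤ 2 * n),
          pullbackEigenclasses A φ (2 * n + 2)
            (fun x y => (((x : ℂ) + (y : ℂ) * Complex.I * (Real.sqrt d : ℂ)) ^ a) *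
              (((x : ℂ) - (y : ℂ) * Complex.I * (Real.sqrt d : ℂ)) ^ b))) ≤
          ⨆ (ν : ℂ) (_ : ν ≠ μ), T.eigenspace ν := by
        refine iSup_le fun a ↦ iSup_le fun b ↦ iSup_le fun hab ↦ iSup_le fun ha ↦ iSup_le fun hb ↦ ?_
        intro z hz
        refine Submodule.mem_iSup_of_mem (u ^ a * w ^ b)
          (Submodule.mem_iSup_of_mem (hne a b hab ha hb) ?_)
        rw [Module.End.mem_eigenspace_iff, hT]
        have hz1 := hz x₀ 1
        simp only [hx1, hx2] at hz1
        exact hz1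
      exact hle (hdec v)
    exact Submodule.disjoint_def.mp ((Module.End.eigenspaces_iSupIndep T) μ) v hvμ hvs
  -- decompose the Weil class and kill each component
  have he1 : singularCohomology.map ℂ ℂ
      (AlgPoints.mapContinuous (L := ℂ) (x₀ • 𝟙 A + (1 : ℕ) • φ).hom.hom.hom) 2 e = (u * w) • e := by
    have h := he x₀ 1
    simp only [hx1, hx2] at h
    exact h
  obtain ⟨c₁, hc₁, c₂, hc₂, rfl⟩ := Submodule.mem_sup.mp hc
  have hc₁1 : singularCohomology.map ℂ ℂ
      (AlgPoints.mapContinuous (L := ℂ) (x₀ • 𝟙 A + (1 : ℕ) • φ).hom.hom.hom) (2 * n) c₁ =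
        u ^ (2 * n) • c₁ := by
    have h := hc₁ x₀ 1
    simp only [hx1] at h
    exact h
  have hc₂1 : singularCohomology.map ℂ ℂ
      (AlgPoints.mapContinuous (L := ℂ) (x₀ • 𝟙 A + (1 : ℕ) • φ).hom.hom.hom) (2 * n) c₂ =
        w ^ (2 * n) • c₂ := by
    have h := hc₂ x₀ 1
    simp only [hx2] at h
    exact h
  have hv₁ : cupProduct (R := ℂ) (add_comm 2 (2 * n)) e c₁ = 0 := by
    refine key (u ^ (2 * n) * (u * w)) _ ?_ ?_
    · rw [cupProduct_map, he1, hc₁1, map_smul, map_smul, LinearMap.smul_apply, smul_smul]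
    · intro a b hab ha hb h
      obtain ⟨k, hk⟩ : ∃ k, 2 * n + 1 = a + k := ⟨2 * n + 1 - a, by omega⟩
      have hb' : b = k + 1 := by omega
      apply hx₀ k (by omega) (by omega)
      rw [hb', show u ^ (2 * n) * (u * w) = u ^ (2 * n + 1) * w by ring, hk, pow_add, pow_add,
        pow_one] at h
      -- h : u ^ a * (w ^ k * w) = u ^ a * u ^ k * w
      have h' : u ^ a * (w ^ k * w) = u ^ a * (u ^ k * w) := by rw [h]; ring
      exact (mul_right_cancel₀ hw0 (mul_left_cancel₀ (pow_ne_zero a hu0) h')).symm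
  have hv₂ : cupProduct (R := ℂ) (add_comm 2 (2 * n)) e c₂ = 0 := by
    refine key (w ^ (2 * n) * (u * w)) _ ?_ ?_
    · rw [cupProduct_map, he1, hc₂1, map_smul, map_smul, LinearMap.smul_apply, smul_smul]
    · intro a b hab ha hb h
      obtain ⟨k, hk⟩ : ∃ k, 2 * n + 1 = b + k := ⟨2 * n + 1 - b, by omega⟩
      have ha' : a = k + 1 := by omega
      apply hx₀ k (by omega) (by omega)
      rw [ha', show w ^ (2 * n) * (u * w) = u * w ^ (2 * n + 1) by ring, hk, pow_add, pow_add,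
        pow_one] at h
      -- h : u ^ k * u * w ^ b = u * (w ^ b * w ^ k)
      have h' : u * w ^ b * u ^ k = u * w ^ b * w ^ k := by
        calc u * w ^ b * u ^ k = u ^ k * u * w ^ b := by ring
          _ = u * (w ^ b * w ^ k) := h
          _ = u * w ^ b * w ^ k := by ring
      exact mul_left_cancel₀ (mul_ne_zero hu0 (pow_ne_zero b hw0)) h'
  rw [map_add, hv₁, hv₂, add_zero]

end Summit.HodgeConjecture.HodgeConjecture.Theorems

end
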